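import Mathlib
import Literature.Probability.Percolation.DiagonalStripGroundStateSums
import HarnessLib

/-!
# The sum `Z = Σ_Q ψ_Q` of the ground state is not zero

Topic `Literature/Probability/Percolation`. For the generic ground state of the loop-weight-one transfer
matrix `t(w; z⃗)` of Ikhlef–Ponsaing (J. Stat. Phys. 149 (2012), arXiv:1202.5476, §3.4, §3.6), the
normalisation `Z_L = Σ_α ψ_α` is implicitly nonzero (Prop. 3.4 identifies it with a symplectic
character). We prove it in the cluster language: `groundState_sum_ne_zero` — every nonzero polynomial
`t`-fixed vector has `Σ_Q P_Q ≠ 0`.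

Proof: the rows of the adjugate of the cleared polynomial matrix `Δ (t - 1)` are polynomial fixed
vectors (`adjugate_ipNMat_row_fixed`); at the percolation point `(w₀, 1, …, 1)` (`w₀² = -q`, all tile
weights `½`, `DiagonalStripGenericSimplicity`) this adjugate evaluates to a power of `Δ ≠ 0` times the
adjugate of `t(½) - 1`, whose rows lie on the line of the stationary law `π̄` (`Σ π̄ = 1`) and which is
not zero; so some row has a sum that does not vanish at the point, hence not identically. By generic
simplicity and primitivity every polynomial fixed vector is a polynomial multiple of the primitive one
(`PolyPrimitive.exists_eq_C_mul_of_fixed`), which transfers the non-vanishing to all of them.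

## References

* Y. Ikhlef, A. K. Ponsaing, *Finite-size left-passage probability in percolation*, J. Stat. Phys.
  149 (2012) 10–36, arXiv:1202.5476, §3.4, §3.6 and Prop. 3.4. [IkhlefPonsaing2012]
-/

namespace Literature.Probability.Percolation

open Finset Literature.Probability.LatticeModels Literature.Probability.LatticeModels.TemperleyLieb
  Literature.LinearAlgebra.Matrix

section SumNonvanishing

open _root_.Matrix MvPolynomial

variable {m : ℕ}

/-- `det (Δ (t - 1)) = 0`. [folklore] -/
theorem det_ipNMat_eq_zero {q : ℂ} (hq0 : q ≠ 0) : (ipNMat m q).det = 0 := by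
  apply toRF_injective
  rw [RingHom.map_det, mapMatrix_toRF_ipNMat hq0, det_smul, det_ipTMat_sub_one, mul_zero, map_zero]

/-- **The rows of `adj (Δ (t - 1))` are polynomial `t`-fixed vectors.** [folklore] -/
theorem adjugate_ipNMat_row_fixed {q : ℂ} (hq0 : q ≠ 0) (i : ColPattern m) (Q' : ColPattern m) :
    ∑ Q, ipTransferMatrixW m (genC ℂ q) (genW ℂ) (genZ ℂ) Q Q' * toRF ℂ (adjugate (ipNMat m q) i Q) =
      toRF ℂ (adjugate (ipNMat m q) i Q') := by
  classical
  have h := congrFun (adjugate_row_vecMul (ipNMat m q) (det_ipNMat_eq_zero hq0) i) Q'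
  rw [Pi.zero_apply, vecMul, dotProduct] at h
  have h2 := congrArg (toRF ℂ) h
  rw [map_sum, map_zero] at h2
  simp only [map_mul] at h2
  have hN : ∀ Q, toRF ℂ (ipNMat m q Q Q') = toRF ℂ (ipDeltaPoly m q) * ((ipTMat m q - 1) Q Q') := by
    intro Q
    have := congrFun (congrFun (mapMatrix_toRF_ipNMat (m := m) hq0) Q) Q'
    rw [RingHom.mapMatrix_apply, Matrix.map_apply, Matrix.smul_apply, smul_eq_mul] at this
    exact this
  simp only [hN, Matrix.sub_apply, Matrix.one_apply, ipTMat_apply] at h2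
  have hΔ := toRF_ipDeltaPoly_ne_zero (m := m) (K₀ := ℂ) hq0
  have hrw : ∀ Q, toRF ℂ (adjugate (ipNMat m q) i Q) * (toRF ℂ (ipDeltaPoly m q) *
      (ipTransferMatrixW m (genC ℂ q) (genW ℂ) (genZ ℂ) Q Q' - if Q = Q' then 1 else 0)) =
      toRF ℂ (ipDeltaPoly m q) * (ipTransferMatrixW m (genC ℂ q) (genW ℂ) (genZ ℂ) Q Q' *
        toRF ℂ (adjugate (ipNMat m q) i Q)) -
      toRF ℂ (ipDeltaPoly m q) * (if Q = Q' then toRF ℂ (adjugate (ipNMat m q) i Q) else 0) := by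
    intro Q; split_ifs <;> ring
  rw [Finset.sum_congr rfl fun Q _ => hrw Q, Finset.sum_sub_distrib, ← Finset.mul_sum, ← Finset.mul_sum,
    Finset.sum_ite_eq' Finset.univ Q', if_pos (Finset.mem_univ _), ← mul_sub] at h2
  exact sub_eq_zero.1 ((mul_eq_zero.1 h2).resolve_left hΔ)

/-- `det (t(½) - 1) = 0` (row sums are `1`). [folklore] -/
theorem det_ipTMat0_sub_one (K₀ : Type*) [Field K₀] : (ipTMat0 K₀ m - 1).det = 0 := by
  rw [← exists_mulVec_eq_zero_iff]
  refine ⟨fun _ => 1, ?_, ?_⟩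
  · intro h
    have := congrFun h ((fun _ _ => false), fun _ => false)
    simp at this
  · funext Q
    rw [sub_mulVec, one_mulVec, Pi.sub_apply, Pi.zero_apply, sub_eq_zero, mulVec, dotProduct]
    simp only [mul_one, ipTMat0, of_apply]
    exact sum_ipTwoLayerW _ _ Q

/-- **Some row of `adj (Δ (t - 1))` has a nonzero sum** (seen at the percolation point, where the rows
of `adj (t(½) - 1) ≠ 0` are multiples of `π̄`, `Σ π̄ = 1`). [cite: IkhlefPonsaing2012, §3.4] -/
theorem exists_adjugate_ipNMat_row_sum_ne_zero {q : ℂ} (hq : q ^ 2 + q + 1 = 0) :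
    ∃ i : ColPattern m, ∑ Q', adjugate (ipNMat m q) i Q' ≠ 0 := by
  classical
  obtain ⟨w₀, hw⟩ := IsAlgClosed.exists_pow_nat_eq (-q) (n := 2) two_pos
  have hev : (eval (ipEvalPt w₀)).mapMatrix (adjugate (ipNMat m q)) =
      (eval (ipEvalPt w₀) (ipDeltaPoly m q)) ^ (Fintype.card (ColPattern m) - 1) • adjugate (ipTMat0 ℂ m - 1) := by
    rw [RingHom.map_adjugate, mapMatrix_eval_ipNMat hq hw two_ne_zero, adjugate_smul]
  have hA0 := adjugate_ipTMat0_complex_sub_one_ne_zero (m := m)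
  obtain ⟨i, j, hij⟩ : ∃ i j, adjugate (ipTMat0 ℂ m - 1) i j ≠ 0 := by
    by_contra h
    simp only [not_exists, not_not] at h
    exact hA0 (Matrix.ext fun i j => h i j)
  -- the row `i` of `adj (t(½) - 1)` is a multiple of `π̄`
  obtain ⟨a, ha⟩ := ipTMat0_complex_vecMul_line (fun Q' => adjugate (ipTMat0 ℂ m - 1) i Q')
    (adjugate_row_vecMul _ (det_ipTMat0_sub_one ℂ) i)
  have ha0 : a ≠ 0 := by
    rintro rfl
    exact hij (by have := congrFun ha j; simpa using this)
  have hrow : ∑ Q', adjugate (ipTMat0 ℂ m - 1) i Q' = a := by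
    rw [Finset.sum_congr rfl fun Q' _ => congrFun ha Q']
    simp only [Pi.smul_apply, smul_eq_mul]
    rw [← Finset.mul_sum, ← Complex.ofReal_sum, sum_ipStationaryL, Complex.ofReal_one, mul_one]
  refine ⟨i, fun h0 => ?_⟩
  have h1 := congrArg (eval (ipEvalPt w₀)) h0
  rw [map_sum, map_zero] at h1
  have h2 : ∀ Q', eval (ipEvalPt w₀) (adjugate (ipNMat m q) i Q') =
      (eval (ipEvalPt w₀) (ipDeltaPoly m q)) ^ (Fintype.card (ColPattern m) - 1) * adjugate (ipTMat0 ℂ m - 1) i Q' := by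
    intro Q'
    have := congrFun (congrFun hev i) Q'
    rw [RingHom.mapMatrix_apply, Matrix.map_apply, Matrix.smul_apply, smul_eq_mul] at this
    exact this
  rw [Finset.sum_congr rfl fun Q' _ => h2 Q', ← Finset.mul_sum, hrow] at h1
  exact mul_ne_zero (pow_ne_zero _ (eval_ipDeltaPoly_ne_zero hq hw two_ne_zero)) ha0 h1

/-- **`Z = Σ_Q P_Q ≠ 0` for every nonzero polynomial `t`-fixed vector.** [cite: IkhlefPonsaing2012, §3.6] -/
theorem groundState_sum_ne_zero {q : ℂ} (hq : q ^ 2 + q + 1 = 0) {P : ColPattern m → MvPolynomial ℕ ℂ}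
    (hP0 : P ≠ 0)
    (hP : ∀ Q', ∑ Q, ipTransferMatrixW m (genC ℂ q) (genW ℂ) (genZ ℂ) Q Q' * toRF ℂ (P Q) = toRF ℂ (P Q')) :
    ∑ Q, P Q ≠ 0 := by
  have hq0 : q ≠ 0 := q_ne_zero_of_quad hq
  obtain ⟨P₀, hprim, hP₀⟩ := exists_ipTransferMatrixW_fixed_primitive (m := m) hq
  obtain ⟨i, hi⟩ := exists_adjugate_ipNMat_row_sum_ne_zero (m := m) hq
  obtain ⟨C₁, hC₁⟩ := hprim.exists_eq_C_mul_of_fixed hq hP₀ (Ψ' := fun Q => adjugate (ipNMat m q) i Q)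
    (adjugate_ipNMat_row_fixed hq0 i)
  have hZ₀ : ∑ Q, P₀ Q ≠ 0 := by
    intro h0
    apply hi
    rw [Finset.sum_congr rfl fun Q _ => hC₁ Q, ← Finset.mul_sum, h0, mul_zero]
  obtain ⟨C₂, hC₂⟩ := hprim.exists_eq_C_mul_of_fixed hq hP₀ hP
  have hC₂0 : C₂ ≠ 0 := by
    rintro rfl
    exact hP0 (funext fun Q => by rw [hC₂ Q, zero_mul]; rfl)
  rw [Finset.sum_congr rfl fun Q _ => hC₂ Q, ← Finset.mul_sum]
  exact mul_ne_zero hC₂0 hZ₀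

/-- The same in the rapidity field. [cite: IkhlefPonsaing2012, §3.6] -/
theorem groundState_ipZsum_ne_zero {q : ℂ} (hq : q ^ 2 + q + 1 = 0) {P : ColPattern m → MvPolynomial ℕ ℂ}
    (hP0 : P ≠ 0)
    (hP : ∀ Q', ∑ Q, ipTransferMatrixW m (genC ℂ q) (genW ℂ) (genZ ℂ) Q Q' * toRF ℂ (P Q) = toRF ℂ (P Q')) :
    (ipZsum fun Q => toRF ℂ (P Q)) ≠ 0 := by
  unfold ipZsum
  rw [← map_sum]
  exact fun h => groundState_sum_ne_zero hq hP0 hP (toRF_injective (h.trans (map_zero _).symm))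

end SumNonvanishing

end Literature.Probability.Percolation
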